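import Summits.BirchSwinnertonDyer.BirchSwinnertonDyer.Theorems.ErratumRoadFiveAuxNormReceptacleDefs
import Summits.BirchSwinnertonDyer.BirchSwinnertonDyer.Theorems.ClassRecordThreeEulerHalvesAtThreeShimuraE0Descent
import HarnessLib

/-!
# Route `ErratumRoadFive` (K2, `p ≥ 5`), crux `EulerHalfNotRamNoInertSetAtFive` (item stmt-BirchSwinnertonDyer-19715), line `birth` v15 (= v14 ⊕ the
# `aux_norm_receptacle` graft): THE AUXILIARY-NORM LEVER AS AN IMPORTABLE SORRY-FREE MODULE — Gross's E′-label at every K-split multiplicative carrier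
# from the four leaf statements S1 ∕ S2♭ ∕ (C) ∕ (O) (cell `bsd-stepL`, LEAD `bsd-line-er5-p1` g3; `--supports stmt-BirchSwinnertonDyer-19715 --as helper`)

PROVENANCE. §0–§2 are the sorry-free part of the ideator's crux workfile `Cruxes/EulerHalfNotRamNoInertSetAtFive/Lines/aux_norm_receptacle.lean` v4
(bsd-idea-9 g8, commit 193b9164b81b, sha16 f729ad49848336fd; critic idea-crit-14 VERDICT #50 PASS), proofs VERBATIM, re-homed over the Defs module
`ErratumRoadFiveAuxNormReceptacleDefs` (namespace `…Theorems.AuxNormReceptacle`): crux workfiles are neither importable nor rebuilt with the tree, and skeleton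
v15 of line `birth` + the LEAD's closer `ErratumRoadFiveEulerHalfNotRamNoInertSetOfAuxNorm` need these theorems in the BUILD. (A1) `exists_sum_eq_card_nsmul` is
NOT repeated: tam3-p1 g18 re-homed it as `ShimuraWalk.exists_sum_eq_card_nsmul` (p640602), used here by name. One convenience theorem is added:
`carrierLabelsE0Prime_of_leaves` (the `hE0T` binder straight from the four LEAF statements).

THE LEVER (card `Cruxes/…/Ideas/aux-norm-receptacle.md`): Gross's norm relation (B4) at an AUXILIARY inert level `ℓ₀ m`, read through the Tate component
character `comp_w : E(K[m]) → ℤ/c_q` (S1) at a place `w̃ ∣ w` over a K-split carrier `q`, gives `∑_{i ≤ ℓ₀} comp(σ^{-i} w̃)(y_{ℓ₀m}) = a_{ℓ₀} · comp_w(y_m)`; the left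
side is a `#Stab_{⟨σ⟩}(w̃)`-multiple (§0 (A1′)), S3 makes `p^{ord_p c_q} ∣ #Stab` with `p ∤ a_{ℓ₀}`, so `(c_q / p^{ord_p c_q}) • y_m ∈ ker comp_w = E₀` (§0 (A2)) —
the E′-label with a witness UNIFORM in `m` (width seat -w3 g5's binder `hE0T`). CONTENTS: §0 (A1′) orbit counting, (A2) Bezout in `ZMod c`, (A3) both combined;
§1 the glues `auxiliaryPrimeSupply_of_CO : (C) → (O) → S3♭`, `auxiliaryInertLevel_of_laws : S2♭ → S3♭ → S3`; §2 `labelE0Prime_at_splitCarrier_of_stubs`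
(S1 → S3 → (B4) → `p ∣ c_q` → E′-label at `q`), `…_of_laws`, `carrierLabelsE0Prime_of_stubs`, `carrierLabelsE0Prime_of_leaves`.

HONEST FRAMING: THEOREMS ONLY, each CONDITIONAL on the displayed leaf statements (hypotheses, not assertions); the four leaf statements are the REGISTERED stubs
of skeleton v15 and are NOT proved here; no `sorry`, no definition, no named fact; item 19715 is NOT closed by this file; no census number moves; BSD is proved
for no curve; no summit statement is touched.
References: [cite: GrossLMS1991, §3 Prop. 3.7 (1), §6 proof of Prop. 6.2 (1)] [cite: SilvermanATAEC1994, IV Cor. 9.2 (d)] [cite: Cox2013, §7.D Thm. 7.24, Thm. 8.12, §9.A]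
-/

set_option autoImplicit false
set_option linter.dupNamespace false -- `Summit.BirchSwinnertonDyer.BirchSwinnertonDyer` (summit = problem), tree-wide

noncomputable section

open scoped Classical NumberField Pointwise
namespace Summit.BirchSwinnertonDyer.BirchSwinnertonDyer.Theorems.AuxNormReceptacle

open WeierstrassCurve IsDedekindDomain NumberField Field Literature.NumberTheory.EllipticCurves
  Literature.NumberTheory.GaloisRepresentations Summit.BirchSwinnertonDyer.Rank1Residual.X11b
  Summit.BirchSwinnertonDyer.BirchSwinnertonDyer.Theorems Rat.HeightOneSpectrum
  Literature.NumberTheory.NumberFields Literature.NumberTheory.NumberFields.RingClassField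
  Literature.NumberTheory.QuadraticFields.RingClass

/-! ## §0 Abstract algebra (Mathlib only; (A1) = `ShimuraWalk.exists_sum_eq_card_nsmul`, p640602) -/

/-- (A1′) **Orbit counting along a cyclic group.** For `σ` with `σ ^ n = 1` acting on `X` and any `F : X → A`:
`∑_{i<n} F (σ^{-i} • x)` is a multiple of the order of the stabiliser of `x` in `⟨σ⟩` (in the application: of the
decomposition group, i.e. of the residue degree `f(w̃ ∣ w)`). [folklore] -/
theorem exists_sum_range_eq_card_stabilizer_nsmul {G : Type*} [Group G] {X : Type*} [MulAction G X]
    {A : Type*} [AddCommMonoid A] (σ : G) {n : ℕ} (hn : σ ^ n = 1) (x : X) (F : X → A) :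
    ∃ t : A, ∑ i ∈ Finset.range n, F ((σ ^ i)⁻¹ • x) =
      Nat.card (MulAction.stabilizer (Subgroup.zpowers σ) x) • t := by
  classical
  rcases Nat.eq_zero_or_pos n with rfl | hnpos
  · exact ⟨0, by simp⟩
  have hfin : IsOfFinOrder σ := isOfFinOrder_iff_pow_eq_one.mpr ⟨n, hnpos, hn⟩
  have hd : 0 < orderOf σ := hfin.orderOf_pos
  have hdn : orderOf σ ∣ n := orderOf_dvd_of_pow_eq_one hn
  -- the summand is `orderOf σ`-periodic
  set f : ℕ → A := fun i => F ((σ ^ i)⁻¹ • x) with hfdef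
  have hmul : ∀ k : ℕ, ∑ i ∈ Finset.range (orderOf σ * k), f i = k • ∑ i ∈ Finset.range (orderOf σ), f i := by
    intro k
    induction k with
    | zero => simp
    | succ k ih =>
      rw [Nat.mul_succ, Finset.sum_range_add, ih, succ_nsmul]
      congr 1
      refine Finset.sum_congr rfl fun i _ => ?_
      simp only [hfdef, pow_add, pow_mul, pow_orderOf_eq_one, one_pow, one_mul]
  -- the sum over one period is the sum over the subgroup `⟨σ⟩`
  haveI : Finite (Subgroup.zpowers σ) := Nat.finite_of_card_ne_zero (by rw [Nat.card_zpowers]; exact hd.ne')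
  letI : Fintype (Subgroup.zpowers σ) := Fintype.ofFinite _
  have h1 : ∑ i ∈ Finset.range (orderOf σ), f i = ∑ h : Subgroup.zpowers σ, F ((h : G)⁻¹ • x) := by
    rw [Finset.sum_range]
    exact Fintype.sum_equiv (finEquivZPowers hfin) _ _ fun i => by
      simp [hfdef, finEquivZPowers_apply]
  have h2 : ∑ h : Subgroup.zpowers σ, F ((h : G)⁻¹ • x) = ∑ h : Subgroup.zpowers σ, F ((h : G) • x) :=
    Fintype.sum_equiv (Equiv.inv (Subgroup.zpowers σ)) _ _ fun h => by simp
  obtain ⟨t, ht⟩ := ShimuraWalk.exists_sum_eq_card_nsmul (MulAction.stabilizer (Subgroup.zpowers σ) x)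
    (fun h : Subgroup.zpowers σ => F ((h : G) • x)) fun h d hd => by
      rw [MulAction.mem_stabilizer_iff, Subgroup.smul_def] at hd
      show F (((h * d : Subgroup.zpowers σ) : G) • x) = F ((h : G) • x)
      rw [Subgroup.coe_mul, mul_smul, hd]
  obtain ⟨k, hk⟩ := hdn
  refine ⟨k • t, ?_⟩
  rw [hk, hmul k, h1, h2, ht, smul_comm]

/-- (A2) In `ZMod n`: if `a * x = f * t` with the INTEGER `a` prime to `p`, `p ^ e ∣ n` and `p ^ e ∣ f`, then
`(n / p ^ e) * x = 0` (Bezout `α a + β p^e = 1`). [folklore] -/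
theorem div_pow_mul_eq_zero_of_int {n : ℕ} {p e f : ℕ} {a : ℤ} (hap : IsCoprime a (p : ℤ))
    (hn : p ^ e ∣ n) (hf : p ^ e ∣ f) {x t : ZMod n} (h : (a : ZMod n) * x = (f : ZMod n) * t) :
    ((n / p ^ e : ℕ) : ZMod n) * x = 0 := by
  obtain ⟨α, β, hαβ⟩ := hap.pow_right (n := e)
  have h1 : (a : ZMod n) * (((n / p ^ e : ℕ) : ZMod n) * x) = 0 := by
    have hdvd : n ∣ n / p ^ e * f := by
      obtain ⟨k, hk⟩ := hf
      rw [hk, ← mul_assoc, Nat.div_mul_cancel hn]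
      exact dvd_mul_right n k
    calc (a : ZMod n) * (((n / p ^ e : ℕ) : ZMod n) * x)
        = ((n / p ^ e : ℕ) : ZMod n) * ((a : ZMod n) * x) := by ring
      _ = ((n / p ^ e : ℕ) : ZMod n) * ((f : ZMod n) * t) := by rw [h]
      _ = ((n / p ^ e * f : ℕ) : ZMod n) * t := by push_cast; ring
      _ = 0 := by rw [(ZMod.natCast_eq_zero_iff _ _).mpr hdvd, zero_mul]
  have h2 : ((p : ZMod n) ^ e) * (((n / p ^ e : ℕ) : ZMod n) * x) = 0 := by
    calc ((p : ZMod n) ^ e) * (((n / p ^ e : ℕ) : ZMod n) * x)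
        = ((p ^ e * (n / p ^ e) : ℕ) : ZMod n) * x := by push_cast; ring
      _ = 0 := by rw [Nat.mul_div_cancel' hn, ZMod.natCast_self, zero_mul]
  calc ((n / p ^ e : ℕ) : ZMod n) * x
      = ((α * a + β * (p : ℤ) ^ e : ℤ) : ZMod n) * (((n / p ^ e : ℕ) : ZMod n) * x) := by
        rw [hαβ]; push_cast; ring
    _ = (α : ZMod n) * ((a : ZMod n) * (((n / p ^ e : ℕ) : ZMod n) * x)) +
          (β : ZMod n) * (((p : ZMod n) ^ e) * (((n / p ^ e : ℕ) : ZMod n) * x)) := by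
        push_cast; ring
    _ = 0 := by rw [h1, h2, mul_zero, mul_zero, add_zero]

/-- (A3) **The auxiliary-norm divisibility kills the prime-to-`p` part of the component.** From a norm relation read
in `ZMod c` — `∑_{i<n} F(σ^{-i} • x) = a • z` — with `σ ^ n = 1`, `p ^ e ∣ #Stab_{⟨σ⟩}(x)`, `p ^ e ∣ c` and `a` prime to `p`:
`(c / p^e) • z = 0`. [folklore] -/
theorem div_pow_smul_eq_zero_of_sum_range {G : Type*} [Group G] {X : Type*} [MulAction G X] {c : ℕ}
    (σ : G) {n : ℕ} (hn : σ ^ n = 1) (x : X) (F : X → ZMod c) {z : ZMod c} {a : ℤ} {p e : ℕ}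
    (hap : IsCoprime a (p : ℤ)) (hc : p ^ e ∣ c)
    (hstab : p ^ e ∣ Nat.card (MulAction.stabilizer (Subgroup.zpowers σ) x))
    (hsum : ∑ i ∈ Finset.range n, F ((σ ^ i)⁻¹ • x) = a • z) :
    (c / p ^ e) • z = 0 := by
  obtain ⟨t, ht⟩ := exists_sum_range_eq_card_stabilizer_nsmul σ hn x F
  rw [hsum, nsmul_eq_mul, zsmul_eq_mul] at ht
  rw [nsmul_eq_mul]
  exact div_pow_mul_eq_zero_of_int hap hc hstab ht

/-! ## §1 The two glues (sorry-free): S3♭ ⟸ (C) ∧ (O); S3 ⟸ S2♭ ∧ S3♭ -/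

section Glue

variable (W : WeierstrassCurve ℚ) [W.IsElliptic] [W.IsGloballyMinimal] (K : Type) [Field K] [NumberField K]
  (ι : K →+* ℂ)

omit [W.IsElliptic] in
/-- **S3♭ from (C) and (O) (sorry-free glue):** ask (O) for the witness `γ` (and its bad set `T₀`) at exponent `E`, then (C) for `ℓ₀`
outside `T ∪ T₀ ∪ primeFactors N`. [cite: Cox2013, §7.D, Thm. 8.12] -/
theorem auxiliaryPrimeSupply_of_CO {p q N : ℕ} (hN : N ≠ 0)
    (hC : ChebotarevKummerSupply W K p) (hO : SplitPrimeKummerWitness K p q) : AuxiliaryPrimeSupply W K p q N := by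
  intro E T
  obtain ⟨γ, r, T₀, hγ0, hnorm, hnp, hord⟩ := hO E
  obtain ⟨ℓ₀, hℓ₀, hℓ₀T, hℓ₀P, ha, hE1, hnpow⟩ := hC E (T ∪ T₀ ∪ N.primeFactors) γ r hγ0 hnorm hnp
  simp only [Finset.mem_union, not_or] at hℓ₀T
  obtain ⟨⟨hT, hT₀⟩, hNf⟩ := hℓ₀T
  exact ⟨ℓ₀, hℓ₀, hT, fun h ↦ hNf (Nat.mem_primeFactors.mpr ⟨hℓ₀, h, hN⟩), hℓ₀P, ha,
    fun v hv ↦ hord ℓ₀ hℓ₀ hT₀ hℓ₀P hE1 hnpow v hv⟩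

omit [W.IsElliptic] in
/-- **S3 from S2♭ and S3♭ (sorry-free glue).** Given a guarded level `m₀` and an exponent `e`, ask S3♭ for `ℓ₀` outside
`{q} ∪ primeFactors m₀` with `p^{e + D} ∣ orderOf [𝔭_v]_{ℓ₀}`, `D := ord_p #(I_K(m₀)/P_{K,ℤ}(m₀))`; then for `w̃ ∋ q` of
`K[ℓ₀ m₀]` over `v`: `p^{e+D} ∣ orderOf [𝔭_v]_{ℓ₀} ∣ orderOf [𝔭_v]_{ℓ₀m₀} = #Stab · orderOf [𝔭_v]_{m₀}` (S2♭,
`orderOf_primeClass_dvd_of_dvd`) and `ord_p orderOf [𝔭_v]_{m₀} ≤ D` (`orderOf_dvd_natCard`, `finite_ringClassGroup`), so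
`p^e ∣ #Stab`. [cite: Cox2013, §7.C Prop. 7.22, §7.D Thm. 7.24] -/
theorem auxiliaryInertLevel_of_laws [∀ j : ℕ, NumberField (ringClassField K ι j)] (hK : IsImaginaryQuadratic K)
    {p : ℕ} [Fact p.Prime] {q : ℕ} [Fact q.Prime] {N : ℕ} (hqN : q ∣ N)
    (hS2 : RelativeStabilizerLaw K ι q) (hS3 : AuxiliaryPrimeSupply W K p q N) :
    AuxiliaryInertLevel W K ι p q N := by
  have hp : p.Prime := Fact.out
  have hq : q.Prime := Fact.out
  intro e m₀ hm₀ hg₀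
  have hm0 : m₀ ≠ 0 := hm₀.ne_zero
  haveI : Finite (RingClassGroup K m₀) := finite_ringClassGroup (K := K) (f := m₀) hK.1 hm0
  obtain ⟨ℓ₀, hℓ₀, hℓ₀T, hℓ₀N, hℓ₀P, haℓ, hord⟩ :=
    hS3 (e + (Nat.card (RingClassGroup K m₀)).factorization p) (insert q m₀.primeFactors)
  have hℓ₀q : ℓ₀ ≠ q := by
    rintro rfl
    exact hℓ₀T (Finset.mem_insert_self _ _)
  have hℓ₀m : ¬ ℓ₀ ∣ m₀ := fun h ↦
    hℓ₀T (Finset.mem_insert_of_mem (Nat.mem_primeFactors.mpr ⟨hℓ₀, h, hm0⟩))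
  have hqm : ¬ q ∣ m₀ := fun h ↦ (hg₀ q (Nat.mem_primeFactors.mpr ⟨hq, h, hm0⟩)).1 hqN
  have hqM : ¬ q ∣ ℓ₀ * m₀ := fun h ↦ ((Nat.Prime.dvd_mul hq).mp h).elim
    (fun h1 ↦ hℓ₀q ((Nat.prime_dvd_prime_iff_eq hq hℓ₀).mp h1).symm) hqm
  refine ⟨ℓ₀, hℓ₀, hℓ₀N, hℓ₀m, hℓ₀P, haℓ, fun σ hσ ↦ ?_⟩
  obtain ⟨hσn, hst⟩ := hS2 m₀ ℓ₀ hm0 hℓ₀ hℓ₀m hℓ₀P hqM σ hσ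
  refine ⟨hσn, fun w hw ↦ ?_⟩
  obtain ⟨v, hqv, hmul⟩ := hst w hw
  -- `v ∤ ℓ₀ m₀` since `q ∈ v` and `q ∤ ℓ₀ m₀`
  have hv' : ¬ Ideal.span {((ℓ₀ * m₀ : ℕ) : 𝓞 K)} ≤ v.asIdeal := by
    intro hle
    have hmem : ((ℓ₀ * m₀ : ℕ) : 𝓞 K) ∈ v.asIdeal := hle (Ideal.mem_span_singleton_self _)
    obtain ⟨a, b, hab⟩ : IsCoprime ((ℓ₀ * m₀ : ℕ) : ℤ) (q : ℤ) :=
      Nat.isCoprime_iff_coprime.mpr (Nat.Coprime.symm ((Nat.Prime.coprime_iff_not_dvd hq).mpr hqM))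
    have h1 : ((a * (ℓ₀ * m₀ : ℕ) + b * q : ℤ) : 𝓞 K) ∈ v.asIdeal := by
      push_cast
      exact v.asIdeal.add_mem (v.asIdeal.mul_mem_left _ (by exact_mod_cast hmem))
        (v.asIdeal.mul_mem_left _ hqv)
    rw [hab, Int.cast_one] at h1
    exact v.isPrime.ne_top ((Ideal.eq_top_iff_one _).mpr h1)
  have hdvd : orderOf (primeClass ℓ₀ v) ∣ orderOf (primeClass (ℓ₀ * m₀) v) :=
    orderOf_primeClass_dvd_of_dvd (dvd_mul_right ℓ₀ m₀) hv'
  have hE : p ^ (e + (Nat.card (RingClassGroup K m₀)).factorization p) ∣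
      Nat.card (MulAction.stabilizer (Subgroup.zpowers σ) w.asIdeal) * orderOf (primeClass m₀ v) := by
    rw [hmul]; exact (hord v hqv).trans hdvd
  -- sizes: both factors are nonzero, and `ord_p orderOf [𝔭_v]_{m₀} ≤ ord_p #RingClassGroup`
  have hb0 : orderOf (primeClass m₀ v) ≠ 0 := (orderOf_pos (primeClass m₀ v)).ne'
  have hbD : (orderOf (primeClass m₀ v)).factorization p ≤ (Nat.card (RingClassGroup K m₀)).factorization p :=
    (Nat.factorization_le_iff_dvd hb0 (Nat.card_pos (α := RingClassGroup K m₀)).ne').mpr (orderOf_dvd_natCard _) p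
  have hfin : IsOfFinOrder σ := isOfFinOrder_iff_pow_eq_one.mpr ⟨ℓ₀ + 1, Nat.succ_pos _, hσn⟩
  haveI : Finite (Subgroup.zpowers σ) :=
    Nat.finite_of_card_ne_zero (by rw [Nat.card_zpowers]; exact hfin.orderOf_pos.ne')
  have ha0 : Nat.card (MulAction.stabilizer (Subgroup.zpowers σ) w.asIdeal) ≠ 0 := Nat.card_pos.ne'
  have key := (hp.pow_dvd_iff_le_factorization (mul_ne_zero ha0 hb0)).mp hE
  rw [Nat.factorization_mul ha0 hb0, Finsupp.add_apply] at key
  exact (hp.pow_dvd_iff_le_factorization ha0).mpr (by omega)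

end Glue

/-! ## §2 The composition (sorry-free): S1 ∧ S3 ∧ (B4) ∧ `p ∣ c_q` ⟹ the E′-label at the split carrier `q` -/

section Composition

variable (W : WeierstrassCurve ℚ) [W.IsElliptic] [W.IsGloballyMinimal] {K : Type} [Field K] [NumberField K]
  (ι : K →+* ℂ)

set_option maxHeartbeats 1600000 in
/-- **The E′-label at a K-split multiplicative carrier from the two stubs.** On `K` imaginary quadratic with the ring class tower
`K[·] ⊂ ℂ`, a prime `p ≥ 5`, a prime `q ∣ N` with `p ∣ c_q(E/ℚ_q)`, a family `ys` carrying Gross's norm relation (B4) (the fifth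
conjunct of `ShimuraWalk.LabelsAt`), the statements S1 (at `q`) and S3 (at `p, q, N`): there is ONE `n'` prime to `p` (namely
`c_q / p^{ord_p c_q}`) with `n' • ys m ∈ E₀(K[m])_w` at every guarded level `m` and every place `w ∋ q` — VERBATIM the conclusion of
the binder `hE0T` of `ShimuraKolyvaginOfImage.exists_uniform_exponent_of_carrierLabelsE0Prime` at `q`. Proof: §0 (A3) applied to
(B4) at the auxiliary level `ℓ₀ m` of S3 read through the component character of S1 at a place `w̃ ∣ w`.
[cite: GrossLMS1991, §3 Prop. 3.7 (1), §6 p. 245] [cite: SilvermanATAEC1994, IV Cor. 9.2 (d)] -/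
theorem labelE0Prime_at_splitCarrier_of_stubs [∀ j : ℕ, NumberField (ringClassField K ι j)]
    (hK : IsImaginaryQuadratic K) {p : ℕ} [Fact p.Prime] (hp5 : 5 ≤ p) {q : ℕ} [Fact q.Prime] {N : ℕ} (hqN : q ∣ N)
    (hS1 : TateComponentFamily W K ι q) (hS3 : AuxiliaryInertLevel W K ι p q N)
    (ys : (m : ℕ) → (W.baseChange (ringClassField K ι m)).toAffine.Point)
    {y : (W.baseChange K).toAffine.Point} {ε : ℤ} (hLab : ShimuraWalk.LabelsAt W N K ι y ys ε)
    (htam : p ∣ (W.baseChange ℚ_[q]).localTamagawaNumber ℤ_[q]) :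
    ∃ n' : ℕ, ¬ p ∣ n' ∧ ∀ m : ℕ, Squarefree m → (∀ r ∈ m.primeFactors, ¬ r ∣ N ∧ (Ideal.span {(r : 𝓞 K)}).IsPrime) →
      ∀ [NumberField (ringClassField K ι m)] (w : HeightOneSpectrum (𝓞 (ringClassField K ι m))),
        ((q : ℕ) : 𝓞 (ringClassField K ι m)) ∈ w.asIdeal →
        (placeIntModel W (ringClassField K ι m) w).HasNonsingularReduction (K := ringClassField K ι m) (n' • ys m) := by
  have hp : p.Prime := Fact.out
  have hq : q.Prime := Fact.out
  -- `q` is split multiplicative and `c := ord_q Δ_min = c_q ≠ 0`, `p ∣ c`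
  haveI : (W.baseChange ℚ_[q]).IsElliptic := inferInstanceAs (W.map (algebraMap ℚ ℚ_[q])).IsElliptic
  have hs : W.HasSplitMultiplicativeReductionAtPrime q :=
    hasSplitMultiplicativeReduction_of_five_le_of_dvd_localTamagawaNumber q (W.baseChange ℚ_[q]) hp5 htam
  obtain ⟨v, hv⟩ : ∃ v : HeightOneSpectrum ℤ, (primesEquiv v : ℕ) = q :=
    ⟨primesEquiv.symm ⟨q, hq⟩, by rw [Equiv.apply_symm_apply]⟩
  have hcq : (W.baseChange ℚ_[q]).localTamagawaNumber ℤ_[q] = padicValInt q W.minimalDiscriminantInt :=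
    localTamagawaNumber_eq_padicValInt_of_split W v hv hs
  have hc0 : padicValInt q W.minimalDiscriminantInt ≠ 0 := by
    rw [← hcq]; exact localTamagawaNumber_padic_ne_zero_holds q (W.baseChange ℚ_[q])
  have hpc : p ∣ padicValInt q W.minimalDiscriminantInt := by rw [← hcq]; exact htam
  have hpe : p ^ (padicValInt q W.minimalDiscriminantInt).factorization p ∣ padicValInt q W.minimalDiscriminantInt :=
    Nat.ordProj_dvd _ _
  obtain ⟨comp, hK1, hK2, hK3⟩ := hS1
  refine ⟨padicValInt q W.minimalDiscriminantInt / p ^ (padicValInt q W.minimalDiscriminantInt).factorization p,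
    Nat.not_dvd_ordCompl hp hc0, fun m₀ hm₀ hg₀ _ w₀ hw₀ ↦ ?_⟩
  -- the auxiliary level `ℓ₀ m₀`
  obtain ⟨ℓ₀, hℓ₀, hℓ₀N, hℓ₀m, hℓ₀P, haℓ, hgrp⟩ :=
    hS3 ((padicValInt q W.minimalDiscriminantInt).factorization p) m₀ hm₀ hg₀
  have hm0 : m₀ ≠ 0 := hm₀.ne_zero
  have hM0 : ℓ₀ * m₀ ≠ 0 := mul_ne_zero hℓ₀.ne_zero hm0
  have hqm : ¬ q ∣ m₀ := fun h ↦ (hg₀ q (Nat.mem_primeFactors.mpr ⟨hq, h, hm0⟩)).1 hqN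
  have hqℓ : q ≠ ℓ₀ := fun h ↦ hℓ₀N (h ▸ hqN)
  have hqM : ¬ q ∣ ℓ₀ * m₀ := fun h ↦ ((Nat.Prime.dvd_mul hq).mp h).elim
    (fun h1 ↦ hqℓ ((Nat.prime_dvd_prime_iff_eq hq hℓ₀).mp h1)) hqm
  have hsqM : Squarefree (ℓ₀ * m₀) :=
    (Nat.squarefree_mul ((Nat.Prime.coprime_iff_not_dvd hℓ₀).mpr hℓ₀m)).mpr ⟨hℓ₀.prime.squarefree, hm₀⟩
  have hgM : ∀ r ∈ (ℓ₀ * m₀).primeFactors, ¬ r ∣ N ∧ (Ideal.span {(r : 𝓞 K)}).IsPrime := by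
    intro r hr
    rw [Nat.primeFactors_mul hℓ₀.ne_zero hm0, Finset.mem_union] at hr
    rcases hr with hr | hr
    · rw [hℓ₀.primeFactors, Finset.mem_singleton] at hr
      subst hr
      exact ⟨hℓ₀N, hℓ₀P⟩
    · exact hg₀ r hr
  have hℓmem : ℓ₀ ∈ (ℓ₀ * m₀).primeFactors := Nat.mem_primeFactors.mpr ⟨hℓ₀, dvd_mul_right _ _, hM0⟩
  -- a generator `σ` of `G_{ℓ₀}`; work at the level pair `(ℓ₀ m₀, ℓ₀ m₀ / ℓ₀)` and transport to `m₀` at the end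
  obtain ⟨σ, hσ⟩ := RingClassGalOverCyclic.exists_zpowers_eq_ringClassGalOver_mul hK ι hm0 hℓ₀ hℓ₀m hℓ₀P
  obtain ⟨hσn, hstab⟩ := hgrp σ hσ
  have hdiv : ℓ₀ * m₀ / ℓ₀ = m₀ := Nat.mul_div_cancel_left m₀ hℓ₀.pos
  have hle' : ringClassField K ι (ℓ₀ * m₀ / ℓ₀) ≤ ringClassField K ι (ℓ₀ * m₀) :=
    ringClassField_div_le hK ι (dvd_mul_right ℓ₀ m₀) hM0
  have hσ' : Subgroup.zpowers σ = ringClassGalOver ι (ℓ₀ * m₀) (ℓ₀ * m₀ / ℓ₀) := by rw [hdiv]; exact hσ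
  have hm0' : ℓ₀ * m₀ / ℓ₀ ≠ 0 := by rw [hdiv]; exact hm0
  have hqm' : ¬ q ∣ ℓ₀ * m₀ / ℓ₀ := by rw [hdiv]; exact hqm
  -- (B4) at level `ℓ₀ m₀` with `ℓ = ℓ₀`
  have h4 := hLab.2.2.2.2.1 (ℓ₀ * m₀) hsqM hgM ℓ₀ hℓmem hle' σ hσ'
  obtain ⟨f, h4f, hfcoe⟩ : ∃ f : ringClassField K ι (ℓ₀ * m₀ / ℓ₀) →ₐ[ℚ] ringClassField K ι (ℓ₀ * m₀),
      _ = W.frobeniusTrace ℓ₀ • WeierstrassCurve.Affine.Point.map (W' := W) f (ys (ℓ₀ * m₀ / ℓ₀)) ∧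
      (∀ x : ringClassField K ι (ℓ₀ * m₀ / ℓ₀), ((f x : ringClassField K ι (ℓ₀ * m₀)) : ℂ) = (x : ℂ)) :=
    ⟨_, h4, fun x ↦ RingClassField.coe_inclusion ι hle' x⟩
  -- the E′-label at level `ℓ₀ m₀ / ℓ₀`, every place `w₁ ∋ q`
  have hfin : ∀ (w₁ : HeightOneSpectrum (𝓞 (ringClassField K ι (ℓ₀ * m₀ / ℓ₀)))),
      ((q : ℕ) : 𝓞 (ringClassField K ι (ℓ₀ * m₀ / ℓ₀))) ∈ w₁.asIdeal →
      (placeIntModel W (ringClassField K ι (ℓ₀ * m₀ / ℓ₀)) w₁).HasNonsingularReduction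
        (K := ringClassField K ι (ℓ₀ * m₀ / ℓ₀))
        ((padicValInt q W.minimalDiscriminantInt / p ^ (padicValInt q W.minimalDiscriminantInt).factorization p) •
          ys (ℓ₀ * m₀ / ℓ₀)) := by
    intro w₁ hw₁
    -- a place `w̃ ∣ w₁` of `K[ℓ₀ m₀]` with compatible component characters (K2)
    obtain ⟨wt, hwtq, hwt⟩ := hK2 (ℓ₀ * m₀) (ℓ₀ * m₀ / ℓ₀) hM0 hqM (Nat.div_dvd_of_dvd (dvd_mul_right ℓ₀ m₀))
      f hfcoe w₁ hw₁
    -- read (B4) through `comp_{w̃}`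
    have key := congrArg (comp (ℓ₀ * m₀) wt) h4f
    rw [map_sum, map_zsmul, hwt (ys (ℓ₀ * m₀ / ℓ₀))] at key
    -- the conjugate places `σ^{-i} w̃`, as a function `F` on ideals
    set F : Ideal (𝓞 (ringClassField K ι (ℓ₀ * m₀))) → ZMod (padicValInt q W.minimalDiscriminantInt) :=
      fun I ↦ if h : I.IsPrime ∧ I ≠ ⊥ then comp (ℓ₀ * m₀) ⟨I, h.1, h.2⟩ (ys (ℓ₀ * m₀)) else 0 with hFdef
    have hI : ∀ i : ℕ, ((σ ^ i)⁻¹ • wt.asIdeal).IsPrime ∧ (σ ^ i)⁻¹ • wt.asIdeal ≠ ⊥ := by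
      intro i
      refine ⟨(Ideal.IsPrime.smul_iff _).mpr wt.isPrime, fun h ↦ wt.ne_bot ?_⟩
      have := congrArg (fun J : Ideal (𝓞 (ringClassField K ι (ℓ₀ * m₀))) ↦ (σ ^ i) • J) h
      simpa only [smul_inv_smul, Ideal.smul_bot] using this
    have hF : ∀ i : ℕ, F ((σ ^ i)⁻¹ • wt.asIdeal) = comp (ℓ₀ * m₀) ⟨_, (hI i).1, (hI i).2⟩ (ys (ℓ₀ * m₀)) :=
      fun i ↦ by rw [hFdef]; exact dif_pos (hI i)
    have key2 : ∑ i ∈ Finset.range (ℓ₀ + 1), F ((σ ^ i)⁻¹ • wt.asIdeal) =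
        W.frobeniusTrace ℓ₀ • comp (ℓ₀ * m₀ / ℓ₀) w₁ (ys (ℓ₀ * m₀ / ℓ₀)) := by
      rw [← key]
      refine Finset.sum_congr rfl fun i _ ↦ ?_
      rw [hF i]
      exact (hK3 (ℓ₀ * m₀) hM0 hqM (σ ^ i) wt ⟨_, (hI i).1, (hI i).2⟩
        (smul_inv_smul (σ ^ i) wt.asIdeal).symm (ys (ℓ₀ * m₀))).symm
    -- (A3): `(c / p^e) • comp_{w₁}(ys _) = 0`
    have hap : IsCoprime (W.frobeniusTrace ℓ₀) (p : ℤ) :=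
      ((Prime.coprime_iff_not_dvd (Nat.prime_iff_prime_int.mp hp)).mpr haℓ).symm
    have hkill := div_pow_smul_eq_zero_of_sum_range σ hσn wt.asIdeal F hap hpe (hstab wt hwtq) key2
    -- conclude by (K1) at `w₁`
    refine (hK1 (ℓ₀ * m₀ / ℓ₀) hm0' hqm' w₁ hw₁ _).mp ?_
    rw [map_nsmul]
    exact hkill
  rw [hdiv] at hfin
  exact hfin w₀ hw₀

/-- **v3 form: the E′-label at a K-split carrier from S1, S2♭, S3♭** (the glue `auxiliaryInertLevel_of_laws` inserted).
[cite: GrossLMS1991, §3 Prop. 3.7 (1), §6 p. 245] [cite: NeukirchANT1999, Ch. VI §7 Thm. (7.3)] -/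
theorem labelE0Prime_at_splitCarrier_of_laws [∀ j : ℕ, NumberField (ringClassField K ι j)]
    (hK : IsImaginaryQuadratic K) {p : ℕ} [Fact p.Prime] (hp5 : 5 ≤ p) {q : ℕ} [Fact q.Prime] {N : ℕ} (hqN : q ∣ N)
    (hS1 : TateComponentFamily W K ι q) (hS2 : RelativeStabilizerLaw K ι q) (hS3 : AuxiliaryPrimeSupply W K p q N)
    (ys : (m : ℕ) → (W.baseChange (ringClassField K ι m)).toAffine.Point)
    {y : (W.baseChange K).toAffine.Point} {ε : ℤ} (hLab : ShimuraWalk.LabelsAt W N K ι y ys ε)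
    (htam : p ∣ (W.baseChange ℚ_[q]).localTamagawaNumber ℤ_[q]) :
    ∃ n' : ℕ, ¬ p ∣ n' ∧ ∀ m : ℕ, Squarefree m → (∀ r ∈ m.primeFactors, ¬ r ∣ N ∧ (Ideal.span {(r : 𝓞 K)}).IsPrime) →
      ∀ [NumberField (ringClassField K ι m)] (w : HeightOneSpectrum (𝓞 (ringClassField K ι m))),
        ((q : ℕ) : 𝓞 (ringClassField K ι m)) ∈ w.asIdeal →
        (placeIntModel W (ringClassField K ι m) w).HasNonsingularReduction (K := ringClassField K ι m) (n' • ys m) :=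
  labelE0Prime_at_splitCarrier_of_stubs W ι hK hp5 hqN hS1 (auxiliaryInertLevel_of_laws W K ι hK hqN hS2 hS3) ys hLab htam

/-- **The binder `hE0T` from the stubs on a `p ≥ 5` Shimura frame** (`hsp`: every prime of `N` outside `S` splits in `K`): the
per-carrier E′-labels at every `q ∣ N`, `q ∉ S`, `p ∣ c_q(E/ℚ_q)` — from S1 at each such `q` (the carriers are split multiplicative
by Kodaira–Néron, `c_q ≤ 4 < p` otherwise) and S3 at `(p, q, N)`, and the (B4) conjunct of `LabelsAt`. This is VERBATIM the
hypothesis `hE0T` of `ShimuraKolyvaginOfImage.exists_uniform_exponent_of_carrierLabelsE0Prime` and of the two producers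
`ShimuraWalk.kolyvaginClass_familyData_mem_selmerLocalKer_of_labelsAt_of_tamagawa_of_E0Prime` ∕
`ShimuraWalk.localization_kolyvaginClass_familyData_mem_stringentFamily_of_labelE0Prime_singleton` (width seat -w3 g5).
[cite: GrossLMS1991, §6 proof of Prop. 6.2 (1), p. 245] [cite: SilvermanATAEC1994, IV Cor. 9.2 (d)] -/
theorem carrierLabelsE0Prime_of_stubs [∀ j : ℕ, NumberField (ringClassField K ι j)]
    (hK : IsImaginaryQuadratic K) {p : ℕ} [Fact p.Prime] (hp5 : 5 ≤ p) {N : ℕ} {S : Finset ℕ}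
    (hS1 : ∀ (q : ℕ) [Fact q.Prime], q ∣ N → q ∉ S → W.HasSplitMultiplicativeReductionAtPrime q →
      TateComponentFamily W K ι q)
    (hS3 : ∀ (q : ℕ) [Fact q.Prime], q ∣ N → q ∉ S → AuxiliaryInertLevel W K ι p q N)
    (ys : (m : ℕ) → (W.baseChange (ringClassField K ι m)).toAffine.Point)
    {y : (W.baseChange K).toAffine.Point} {ε : ℤ} (hLab : ShimuraWalk.LabelsAt W N K ι y ys ε) :
    ∀ (q : ℕ) [Fact q.Prime], q ∣ N → q ∉ S → p ∣ (W.baseChange ℚ_[q]).localTamagawaNumber ℤ_[q] →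
      ∃ n' : ℕ, ¬ p ∣ n' ∧ ∀ m : ℕ, Squarefree m → (∀ r ∈ m.primeFactors, ¬ r ∣ N ∧ (Ideal.span {(r : 𝓞 K)}).IsPrime) →
        ∀ [NumberField (ringClassField K ι m)] (w : HeightOneSpectrum (𝓞 (ringClassField K ι m))),
          ((q : ℕ) : 𝓞 (ringClassField K ι m)) ∈ w.asIdeal →
          (placeIntModel W (ringClassField K ι m) w).HasNonsingularReduction (K := ringClassField K ι m) (n' • ys m) := by
  intro q _ hqN hqS htam
  haveI : (W.baseChange ℚ_[q]).IsElliptic := inferInstanceAs (W.map (algebraMap ℚ ℚ_[q])).IsElliptic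
  have hs : W.HasSplitMultiplicativeReductionAtPrime q :=
    hasSplitMultiplicativeReduction_of_five_le_of_dvd_localTamagawaNumber q (W.baseChange ℚ_[q]) hp5 htam
  exact labelE0Prime_at_splitCarrier_of_stubs W ι hK hp5 hqN (hS1 q hqN hqS hs) (hS3 q hqN hqS) ys hLab htam

/-- **The binder `hE0T` from the four LEAF statements S1, S2♭, (C), (O) on a `p ≥ 5` Shimura frame** (`hsp`: every prime of `N` outside `S` splits in `K`;
`N ≠ 0`): `carrierLabelsE0Prime_of_stubs` with S3 assembled by `auxiliaryInertLevel_of_laws` from S2♭ and `auxiliaryPrimeSupply_of_CO` from (C), (O).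
This is the form skeleton v15 of line `birth` consumes. [cite: GrossLMS1991, §6 proof of Prop. 6.2 (1), p. 245] [cite: Cox2013, §7.D, Thm. 8.12] -/
theorem carrierLabelsE0Prime_of_leaves [∀ j : ℕ, NumberField (ringClassField K ι j)]
    (hK : IsImaginaryQuadratic K) {p : ℕ} [Fact p.Prime] (hp5 : 5 ≤ p) {N : ℕ} (hN : N ≠ 0) {S : Finset ℕ}
    (hsp : ∀ ℓ : ℕ, ℓ.Prime → ℓ ∣ N → ℓ ∉ S → ((Ideal.span {(ℓ : ℤ)}).primesOver (𝓞 K)).ncard = 2)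
    (hS1 : ∀ (q : ℕ) [Fact q.Prime], W.HasSplitMultiplicativeReductionAtPrime q →
      ((Ideal.span {(q : ℤ)}).primesOver (𝓞 K)).ncard = 2 → TateComponentFamily W K ι q)
    (hS2 : ∀ (q : ℕ) [Fact q.Prime], RelativeStabilizerLaw K ι q)
    (hC : ChebotarevKummerSupply W K p)
    (hO : ∀ (q : ℕ) [Fact q.Prime], ((Ideal.span {(q : ℤ)}).primesOver (𝓞 K)).ncard = 2 → SplitPrimeKummerWitness K p q)
    (ys : (m : ℕ) → (W.baseChange (ringClassField K ι m)).toAffine.Point)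
    {y : (W.baseChange K).toAffine.Point} {ε : ℤ} (hLab : ShimuraWalk.LabelsAt W N K ι y ys ε) :
    ∀ (q : ℕ) [Fact q.Prime], q ∣ N → q ∉ S → p ∣ (W.baseChange ℚ_[q]).localTamagawaNumber ℤ_[q] →
      ∃ n' : ℕ, ¬ p ∣ n' ∧ ∀ m : ℕ, Squarefree m → (∀ r ∈ m.primeFactors, ¬ r ∣ N ∧ (Ideal.span {(r : 𝓞 K)}).IsPrime) →
        ∀ [NumberField (ringClassField K ι m)] (w : HeightOneSpectrum (𝓞 (ringClassField K ι m))),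
          ((q : ℕ) : 𝓞 (ringClassField K ι m)) ∈ w.asIdeal →
          (placeIntModel W (ringClassField K ι m) w).HasNonsingularReduction (K := ringClassField K ι m) (n' • ys m) := by
  intro q _ hqN hqS htam
  haveI : (W.baseChange ℚ_[q]).IsElliptic := inferInstanceAs (W.map (algebraMap ℚ ℚ_[q])).IsElliptic
  have hs : W.HasSplitMultiplicativeReductionAtPrime q :=
    hasSplitMultiplicativeReduction_of_five_le_of_dvd_localTamagawaNumber q (W.baseChange ℚ_[q]) hp5 htam
  have hq2 : ((Ideal.span {(q : ℤ)}).primesOver (𝓞 K)).ncard = 2 := hsp q Fact.out hqN hqS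
  exact labelE0Prime_at_splitCarrier_of_laws W ι hK hp5 hqN (hS1 q hs hq2) (hS2 q)
    (auxiliaryPrimeSupply_of_CO W K hN hC (hO q hq2)) ys hLab htam

end Composition

end Summit.BirchSwinnertonDyer.BirchSwinnertonDyer.Theorems.AuxNormReceptacle

end
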